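import Literature.NumberTheory.CubicFields.HasseThreeTorsionDictionary
import Literature.NumberTheory.CubicFields.HasseDictionaryProofs
import HarnessLib

/-!
# Hasse's dictionary, imaginary case: discharge of `Hasse1930_threeTorsion_dictionary_neg`

`Proofs` file (theorems only, no definition, no named fact), topic
`Literature/NumberTheory/CubicFields`.  The named fact
`Literature.NumberTheory.CubicFields.Hasse1930_threeTorsion_dictionary_neg`
(`HasseThreeTorsionDictionary.lean`: for every negative fundamental discriminant `D`,
`#Cl(ℚ(√D))[3] = 2 · #{cubic fields of discriminant D} + 1`; Hasse 1930, Bhargava–Shankar–Tsimerman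
§8.5, Bhargava–Taniguchi–Thorne p. 3) is the restriction to `D ∈ negFundDiscrs X` of the tree's
PROVED dictionary for all fundamental discriminants,
`quadFieldThreeTorsion_eq_two_mul_cubicFieldCountOfDisc_add_one` (`HasseDictionaryProofs.lean`:
index-`3` subgroups of `Cl(ℚ(√D))` ↔ unramified `C₃`-extensions (Artin reciprocity,
`natCard_unramifiedCubic_eq`) ↔ cubic fields of discriminant `D` (Hasse's correspondence), and
`#Cl₃ = 2·#{index-3 subgroups} + 1`).  This file only assembles the two (it cannot live in
`HasseThreeTorsionDictionary.lean`, which is upstream of the proof); the corollaries of that file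
(`three_dvd_classNumber_of_one_le_cubicFieldCountOfDisc`, the BTT bridge) become unconditional.

## References

* H. Hasse, *Arithmetische Theorie der kubischen Zahlkörper auf klassenkörpertheoretischer
  Grundlage*, Math. Z. 31 (1930) 565–582. [Hasse1930]
* M. Bhargava, A. Shankar, J. Tsimerman, *On the Davenport–Heilbronn theorems and second order
  terms*, Invent. Math. 193 (2013), §8.5. [BhargavaShankarTsimerman2012]
* M. Bhargava, T. Taniguchi, F. Thorne, *Improved error estimates for the Davenport–Heilbronn
  theorems*, Math. Ann. 389 (2024), p. 3. [BhargavaTaniguchiThorne2023]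
-/

noncomputable section

namespace Literature.NumberTheory.CubicFields

open Literature.NumberTheory.QuadraticFields

/-- **Hasse's dictionary in the imaginary case holds** (discharge of the named fact
`Hasse1930_threeTorsion_dictionary_neg`): for every `X` and every `D ∈ negFundDiscrs X`,
`quadFieldThreeTorsion D = 2 * cubicFieldCountOfDisc D + 1`.
[cite: BhargavaShankarTsimerman2012, §8.5] [cite: BhargavaTaniguchiThorne2023, p. 3] -/
theorem Hasse1930_threeTorsion_dictionary_neg_holds : Hasse1930_threeTorsion_dictionary_neg :=
  fun _ _ hD => quadFieldThreeTorsion_eq_two_mul_cubicFieldCountOfDisc_add_one (mem_negFundDiscrs.mp hD).2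

/-- **A cubic field of negative fundamental discriminant `D` forces `3 ∣ h(D)`**, unconditionally
(`three_dvd_classNumber_of_one_le_cubicFieldCountOfDisc` fed with the discharged dictionary).
[cite: BhargavaTaniguchiThorne2023, p. 3] -/
theorem three_dvd_classNumber_of_one_le_cubicFieldCountOfDisc' {D : ℤ}
    (hD : (D % 4 = 1 ∧ Squarefree D ∧ D ≠ 1) ∨
      (4 ∣ D ∧ (D / 4 % 4 = 2 ∨ D / 4 % 4 = 3) ∧ Squarefree (D / 4)))
    (hD0 : D < 0) (hc : 1 ≤ cubicFieldCountOfDisc D) :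
    3 ∣ BinaryQuadraticForm.classNumber D :=
  three_dvd_classNumber_of_one_le_cubicFieldCountOfDisc Hasse1930_threeTorsion_dictionary_neg_holds
    hD hD0 hc

end Literature.NumberTheory.CubicFields

end
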